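import Literature.AnabelianGeometry.AbsoluteAnabelian.ArchimedeanReconstruction
import HarnessLib

/-!
# [AbsTopIII] Cor 2.7 (c): uniqueness of the group law extending the torsion points (proved), and
# the reduction of the named fact to its density clause

Proof-only companion (theorems only, no new definitions) of `ArchimedeanReconstruction.lean` (seat
abc-iut-L4-t12 adopting abc-iut-L4-t2's draft; S. Mochizuki, *Topics in Absolute Anabelian Geometry
III*, Cor. 2.7 (c) p. 59, kurims manuscript, lit key `paper:url-5493eb38cbb7`): "since the torsion
points of (b) are dense in `E^top`, one may construct the group structure on [the one-point
compactification of] `E^top` [...] as the unique topological group structure that extends the group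
structure on the torsion points of (b)".

The named fact `TorsionPointsDenseUniqueGroupLaw` is, for every punctured elliptic curve `E`, the
conjunction of (A) DENSITY of the cuspidal torsion points and (B) UNIQUENESS: two topological group
laws on `OnePoint E` agreeing on the cuspidal torsion points coincide.  Here:

* `addCommGroup_eq_of_eqOn_dense` — two topological (additive, commutative) group structures on a
  Hausdorff space whose additions agree on a dense subset are EQUAL (continuity + `AddCommGroup.ext`);
* `TorsionPointsDenseUniqueGroupLaw.IsPuncturedEllipticCurve.noncompactSpace` — a punctured elliptic
  curve is not compact (else the puncture would be an isolated point of the connected torus);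
* `torsionPoints_groupLaw_unique` — (B) PROVED from (A): dense in `E` ⇒ dense in the one-point
  compactification (`E` non-compact, locally compact Hausdorff);
* `torsionPointsDenseUniqueGroupLaw_iff_dense` — the named fact REDUCES to its density clause (A)
  (which needs the elliptic cuspidalization diagrams `[N] : 𝔼 → 𝔼`, i.e. complex tori as Riemann
  surfaces — not in this file).

HONEST FRAMING: OUR kernel check of (half of) a statement of a refereed paper; nothing here bears on
[IUTchIII] Cor. 3.12.
-/

noncomputable section

namespace Literature.AnabelianGeometry.AbsoluteAnabelian

open _root_.TopologicalSpace _root_.Topology _root_.Filter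
open scoped _root_.Manifold _root_.ContDiff

/-! ### Topological group laws are determined on a dense subset -/

/-- Two topological additive commutative group structures on a Hausdorff space whose additions agree
on a dense subset are equal (the additions are continuous maps `X × X → X` agreeing on the dense
`S × S`; an additive commutative group structure is determined by its addition).  The abstract content
of "the unique topological group structure that extends the group structure on the torsion points",
Cor. 2.7 (c) p. 59. [cite: MochizukiAbsTopIII2015, Corollary 2.7 (c) p.59] -/
theorem addCommGroup_eq_of_eqOn_dense {X : Type*} [TopologicalSpace X] [T2Space X] {S : Set X}
    (hS : Dense S) (g₁ g₂ : AddCommGroup X)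
    (h₁ : @IsTopologicalAddGroup X _ g₁.toAddGroup) (h₂ : @IsTopologicalAddGroup X _ g₂.toAddGroup)
    (h : ∀ x ∈ S, ∀ y ∈ S,
      @HAdd.hAdd _ _ _ (@instHAdd _ g₁.toAdd) x y = @HAdd.hAdd _ _ _ (@instHAdd _ g₂.toAdd) x y) :
    g₁ = g₂ := by
  -- the two additions as maps `X × X → X`
  let a₁ : X × X → X := fun p => @HAdd.hAdd _ _ _ (@instHAdd _ g₁.toAdd) p.1 p.2
  let a₂ : X × X → X := fun p => @HAdd.hAdd _ _ _ (@instHAdd _ g₂.toAdd) p.1 p.2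
  have hc₁ : Continuous a₁ := @continuous_add X _ g₁.toAdd h₁.toContinuousAdd
  have hc₂ : Continuous a₂ := @continuous_add X _ g₂.toAdd h₂.toContinuousAdd
  have heq : a₁ = a₂ :=
    Continuous.ext_on (hS.prod hS) hc₁ hc₂ fun p hp => h p.1 hp.1 p.2 hp.2
  apply AddCommGroup.ext
  funext x y
  exact congrFun heq (x, y)

/-! ### A punctured elliptic curve is not compact -/

/-- The torus `ℝ/ℤ × ℝ/ℤ` has two distinct points. [folklore] -/
private theorem exists_ne_torus :
    ∃ a b : AddCircle (1 : ℝ) × AddCircle (1 : ℝ), a ≠ b := by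
  refine ⟨Prod.mk (((2 : ℝ)⁻¹ : ℝ) : AddCircle (1 : ℝ)) ((0 : ℝ) : AddCircle (1 : ℝ)),
    Prod.mk ((0 : ℝ) : AddCircle (1 : ℝ)) ((0 : ℝ) : AddCircle (1 : ℝ)), ?_⟩
  intro h
  have h1 : (((2 : ℝ)⁻¹ : ℝ) : AddCircle (1 : ℝ)) = 0 := by
    have := congrArg Prod.fst h
    simpa using this
  rw [AddCircle.coe_eq_zero_iff] at h1
  obtain ⟨n, hn⟩ := h1
  rw [zsmul_eq_mul, mul_one] at hn
  have h2 : (2 : ℝ) * (n : ℝ) = 1 := by rw [hn]; norm_num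
  have h3 : (2 * n : ℤ) = 1 := by exact_mod_cast h2
  omega

/-- **A punctured elliptic curve is not compact**: under the conformal hypothesis
`IsPuncturedEllipticCurve E` (`E ≅ T ∖ {t₀}`, `T` a compact connected Riemann surface homeomorphic to a
torus), compactness of `E` would make `{t₀}` clopen in the connected `T`, so `T` would be a point.
[cite: MochizukiAbsTopIII2015, Corollary 2.7 (a) p.58] -/
theorem TorsionPointsDenseUniqueGroupLaw.IsPuncturedEllipticCurve.noncompactSpace {E : Type}
    [TopologicalSpace E] [ChartedSpace ℂ E]
    (hE : TorsionPointsDenseUniqueGroupLaw.IsPuncturedEllipticCurve E) : NoncompactSpace E := by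
  obtain ⟨T, _, _, _, _, _, _, t₀, e, ⟨φ⟩, -, -⟩ := hE
  rw [← not_compactSpace_iff]
  intro hc
  -- `{t₀}ᶜ` is compact, hence closed, hence `{t₀}` is open
  have h1 : IsCompact (({t₀}ᶜ : Set T)) := by
    have h := isCompact_univ.image e.continuous
    rw [Set.image_univ, Set.range_eq_univ.mpr e.surjective] at h
    have h' := h.image continuous_subtype_val
    rwa [Set.image_univ, Subtype.range_coe] at h'
  have h2 : IsOpen ({t₀} : Set T) := by
    rw [← isClosed_compl_iff]
    exact h1.isClosed
  have h3 : ({t₀} : Set T) = Set.univ :=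
    IsClopen.eq_univ ⟨isClosed_singleton, h2⟩ (Set.singleton_nonempty t₀)
  -- so `T` is a point, contradicting `T ≃ₜ torus`
  obtain ⟨a, b, hab⟩ := exists_ne_torus
  apply hab
  have ha : φ.symm a ∈ ({t₀} : Set T) := by rw [h3]; trivial
  have hb : φ.symm b ∈ ({t₀} : Set T) := by rw [h3]; trivial
  rw [Set.mem_singleton_iff] at ha hb
  exact φ.symm.injective (ha.trans hb.symm)

/-! ### Cor 2.7 (c): uniqueness of the group law (proved); the named fact reduces to density -/

/-- **[AbsTopIII] Cor 2.7 (c), uniqueness half — PROVED**: for a punctured elliptic curve `E` whose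
cuspidal torsion points are dense in `E`, two topological (additive, commutative) group structures on
the one-point compactification `OnePoint E` that agree on the cuspidal torsion points are equal ("the
unique topological group structure that extends the group structure on the torsion points", p. 59).
[cite: MochizukiAbsTopIII2015, Corollary 2.7 (c) p.59] -/
theorem torsionPoints_groupLaw_unique (E : Type) [TopologicalSpace E] [T2Space E]
    [ChartedSpace ℂ E] [IsManifold 𝓘(ℂ, ℂ) ω E]
    (hE : TorsionPointsDenseUniqueGroupLaw.IsPuncturedEllipticCurve E)
    (hD : Dense (cuspidalTorsionPoints E)) :
    ∀ (g₁ g₂ : AddCommGroup (OnePoint E)),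
      @IsTopologicalAddGroup (OnePoint E) _ g₁.toAddGroup →
      @IsTopologicalAddGroup (OnePoint E) _ g₂.toAddGroup →
      (∀ x y : E, x ∈ cuspidalTorsionPoints E → y ∈ cuspidalTorsionPoints E →
        @HAdd.hAdd _ _ _ (@instHAdd _ g₁.toAdd) (x : OnePoint E) y =
          @HAdd.hAdd _ _ _ (@instHAdd _ g₂.toAdd) (x : OnePoint E) y) →
      g₁ = g₂ := by
  intro g₁ g₂ h₁ h₂ h
  haveI : NoncompactSpace E := hE.noncompactSpace
  haveI : LocallyCompactSpace E := ChartedSpace.locallyCompactSpace ℂ E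
  have hdense : Dense (((↑) : E → OnePoint E) '' cuspidalTorsionPoints E) :=
    OnePoint.denseRange_coe.dense_image OnePoint.continuous_coe hD
  refine addCommGroup_eq_of_eqOn_dense hdense g₁ g₂ h₁ h₂ ?_
  rintro _ ⟨x, hx, rfl⟩ _ ⟨y, hy, rfl⟩
  exact h x y hx hy

/-- The named fact `TorsionPointsDenseUniqueGroupLaw` (Cor 2.7 (c), density ∧ uniqueness) REDUCES to
its density clause: "the torsion points of (b) are dense in `E^top`" for every punctured elliptic
curve `E`. [cite: MochizukiAbsTopIII2015, Corollary 2.7 (c) p.59] -/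
theorem torsionPointsDenseUniqueGroupLaw_iff_dense :
    TorsionPointsDenseUniqueGroupLaw ↔
      ∀ (E : Type) [TopologicalSpace E] [T2Space E] [ChartedSpace ℂ E] [IsManifold 𝓘(ℂ, ℂ) ω E],
        TorsionPointsDenseUniqueGroupLaw.IsPuncturedEllipticCurve E → Dense (cuspidalTorsionPoints E) := by
  constructor
  · intro h E _ _ _ _ hE
    exact (h E hE).1
  · intro h E _ _ _ _ hE
    exact ⟨h E hE, torsionPoints_groupLaw_unique E hE (h E hE)⟩

end Literature.AnabelianGeometry.AbsoluteAnabelian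

end
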